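import Mathlib.Analysis.SpecialFunctions.Gaussian.GaussianIntegral
import Mathlib.Analysis.SpecialFunctions.ImproperIntegrals
import Mathlib.Analysis.SpecialFunctions.Integrals.Basic
import Mathlib.MeasureTheory.Integral.IntegralEqImproper
import Mathlib.Analysis.Complex.ExponentialBounds
import HarnessLib

/-!
# Sphere calculus for the K2R refutation line — the radial moments `J_R`, `J'_R`

Route `EnskogAdjointDuality` of `AtomisticToContinuum/HydrodynamicLimit`, crux K2R
(`AdjointEnskogTestFamilyR`, stmt-AtomisticToContinuum-11592), line `refutation`, stub
`stub_sphereCalculus` (file 2 of 3: one-dimensional lemmas on `(0, ∞)`; keyed sub-goal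
`stub_sphereCalculus_radial`).

With `J_R = ∫₀^∞ E²(1+E)⁻³e^{-E/R} dE`, `J'_R = ∫₀^∞ E³(1+E)⁻⁴e^{-E/R} dE` (`R ≥ 1`): integrability
of the moment integrands `Eⁿ(1+E)^{-m}e^{-E/R}` (`n ≤ m`), the logarithmic lower bound
`J_R ≥ ∫₁^R E²(1+E)⁻³e⁻¹ dE ≥ log R/(8e) ≥ log R/25`, `0 ≤ J_R - J'_R = ∫ E²(1+E)⁻⁴e^{-E/R} ≤ π/2`,
plus the substitution `E = r²` and the Gaussian-type integrability of `rⁿe^{-r²/R}` used to pass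
to polar coordinates in `ℝ³`. [folklore]
-/

noncomputable section

open MeasureTheory Real Set Filter

namespace Summit.AtomisticToContinuum.HydrodynamicLimit.Theorems.EnskogAdjointDuality

/-! ### One-dimensional lemmas on `(0, ∞)` -/

/-- `e^{-E/R}` is integrable on `(0, ∞)` for `R > 0`. [folklore] -/
theorem k2r_ref_integrableOn_exp_neg_div {R : ℝ} (hR : 0 < R) :
    IntegrableOn (fun E : ℝ => Real.exp (-E / R)) (Ioi 0) := by
  refine (exp_neg_integrableOn_Ioi 0 (b := 1 / R) (by positivity)).congr_fun (fun E _ => ?_)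
    measurableSet_Ioi
  show Real.exp (-(1 / R) * E) = Real.exp (-E / R)
  congr 1
  ring

/-- Domination on `(0, ∞)`: `g` continuous on `(0, ∞)` with `|g| ≤ G ∈ L¹(0, ∞)` is integrable.
[folklore] -/
theorem k2r_ref_integrableOn_Ioi_of_le {g G : ℝ → ℝ} (hg : ContinuousOn g (Ioi 0))
    (hG : IntegrableOn G (Ioi 0)) (h : ∀ r, 0 < r → |g r| ≤ G r) : IntegrableOn g (Ioi 0) :=
  hG.mono' (hg.aestronglyMeasurable measurableSet_Ioi)
    (ae_restrict_of_forall_mem measurableSet_Ioi fun r hr => by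
      rw [Real.norm_eq_abs]; exact h r hr)

/-- `rⁿ e^{-r²/R}` is integrable on `(0, ∞)` (`R > 0`). [folklore] -/
theorem k2r_ref_integrableOn_pow_mul_exp {R : ℝ} (hR : 0 < R) (n : ℕ) :
    IntegrableOn (fun r : ℝ => r ^ n * Real.exp (-r ^ 2 / R)) (Ioi 0) := by
  have h := integrableOn_rpow_mul_exp_neg_mul_sq (b := 1 / R) (by positivity) (s := n)
    (by have := n.cast_nonneg (α := ℝ); linarith)
  refine h.congr_fun (fun r _ => ?_) measurableSet_Ioi
  simp only [Real.rpow_natCast]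
  congr 1
  ring

/-- `rⁿ ≤ (1 + r²)^m` for `r > 0` and `n ≤ 2m`. [folklore] -/
theorem k2r_ref_pow_le_one_add_sq_pow {r : ℝ} (hr : 0 < r) {n m : ℕ} (h : n ≤ 2 * m) :
    r ^ n ≤ (1 + r ^ 2) ^ m := by
  rcases le_or_gt r 1 with h1 | h1
  · calc r ^ n ≤ 1 := pow_le_one₀ hr.le h1
      _ ≤ (1 + r ^ 2) ^ m := one_le_pow₀ (by nlinarith)
  · calc r ^ n ≤ r ^ (2 * m) := pow_le_pow_right₀ h1.le h
      _ = (r ^ 2) ^ m := pow_mul r 2 m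
      _ ≤ (1 + r ^ 2) ^ m := pow_le_pow_left₀ (sq_nonneg r) (by linarith) m

/-- `0 ≤ rⁿ (1 + r²)^{-m} e ≤ (1 + r²)⁻¹` for `r > 0`, `n + 2 ≤ 2m`, `0 ≤ e ≤ 1`. [folklore] -/
theorem k2r_ref_pow_div_le {r : ℝ} (hr : 0 < r) {n m : ℕ} (h : n + 2 ≤ 2 * m) {e : ℝ}
    (he0 : 0 ≤ e) (he1 : e ≤ 1) :
    0 ≤ r ^ n * ((1 + r ^ 2) ^ m)⁻¹ * e ∧ r ^ n * ((1 + r ^ 2) ^ m)⁻¹ * e ≤ (1 + r ^ 2)⁻¹ := by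
  have hq : 0 < 1 + r ^ 2 := by positivity
  refine ⟨by positivity, ?_⟩
  obtain ⟨m', rfl⟩ : ∃ m', m = m' + 1 := ⟨m - 1, by omega⟩
  have h1 : r ^ n ≤ (1 + r ^ 2) ^ m' := k2r_ref_pow_le_one_add_sq_pow hr (by omega)
  calc r ^ n * ((1 + r ^ 2) ^ (m' + 1))⁻¹ * e ≤ (1 + r ^ 2) ^ m' * ((1 + r ^ 2) ^ (m' + 1))⁻¹ * 1 :=
        mul_le_mul (mul_le_mul_of_nonneg_right h1 (by positivity)) he1 he0 (by positivity)
    _ = (1 + r ^ 2)⁻¹ := by rw [mul_one, pow_succ]; field_simp; ring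

/-- The substitution `E = r²` on `(0, ∞)`: `∫₀^∞ 2r g(r²) dr = ∫₀^∞ g(E) dE`. [folklore] -/
theorem k2r_ref_integral_comp_sq (g : ℝ → ℝ) :
    ∫ r in Ioi (0 : ℝ), 2 * r * g (r ^ 2) = ∫ E in Ioi (0 : ℝ), g E := by
  rw [← integral_comp_rpow_Ioi_of_pos (g := g) two_pos]
  refine setIntegral_congr_fun measurableSet_Ioi fun r _ => ?_
  rw [Real.rpow_two, smul_eq_mul]
  norm_num

/-- `max (r t) 0 = r max(t, 0)` for `r ≥ 0`. [folklore] -/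
theorem k2r_ref_max_mul {r t : ℝ} (hr : 0 ≤ r) : max (r * t) 0 = r * max t 0 := by
  rcases le_or_gt 0 t with h | h
  · rw [max_eq_left h, max_eq_left (mul_nonneg hr h)]
  · rw [max_eq_right h.le, max_eq_right (mul_nonpos_iff.2 (Or.inl ⟨hr, h.le⟩)), mul_zero]

/-! ### The radial moments `J_R`, `J'_R` -/

/-- Continuity on `(0, ∞)` of `E ↦ Eⁿ (1 + E)^{-m} e^{-E/R}`. [folklore] -/
theorem k2r_ref_continuousOn_moment (R : ℝ) (n m : ℕ) :
    ContinuousOn (fun E : ℝ => E ^ n * ((1 + E) ^ m)⁻¹ * Real.exp (-E / R)) (Ioi 0) := by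
  refine (((continuousOn_id.pow n).mul (((continuousOn_const.add continuousOn_id).pow m).inv₀
    fun E hE => ?_)).mul (by fun_prop))
  exact pow_ne_zero _ (add_pos_of_pos_of_nonneg one_pos (le_of_lt (mem_Ioi.1 hE))).ne'

/-- `Eⁿ (1 + E)^{-m} e^{-E/R}` is integrable on `(0, ∞)` for `n ≤ m`, `R > 0` (it is at most
`e^{-E/R}`). [folklore] -/
theorem k2r_ref_integrableOn_moment {R : ℝ} (hR : 0 < R) {n m : ℕ} (h : n ≤ m) :
    IntegrableOn (fun E : ℝ => E ^ n * ((1 + E) ^ m)⁻¹ * Real.exp (-E / R)) (Ioi 0) := by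
  refine k2r_ref_integrableOn_Ioi_of_le (k2r_ref_continuousOn_moment R n m)
    (k2r_ref_integrableOn_exp_neg_div hR) fun E hE => ?_
  have h1 : E ^ n ≤ (1 + E) ^ m :=
    (pow_le_pow_left₀ hE.le (by linarith) n).trans (pow_le_pow_right₀ (by linarith) h)
  rw [abs_of_nonneg (by positivity)]
  calc E ^ n * ((1 + E) ^ m)⁻¹ * Real.exp (-E / R) ≤ (1 + E) ^ m * ((1 + E) ^ m)⁻¹ * Real.exp (-E / R) := by
        gcongr
    _ = Real.exp (-E / R) := by rw [mul_inv_cancel₀ (by positivity), one_mul]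

/-- **The critical radial moments.** With `J_R = ∫₀^∞ E²(1+E)⁻³e^{-E/R} dE` and
`J'_R = ∫₀^∞ E³(1+E)⁻⁴e^{-E/R} dE` (`R ≥ 1`): both integrands are integrable,
`J_R ≥ ∫₁^R E²(1+E)⁻³e⁻¹ ≥ log R/(8e) ≥ log R/25`, `0 ≤ J_R - J'_R = ∫ E²(1+E)⁻⁴e^{-E/R} ≤ π/2`,
`J'_R ≥ 0`. [folklore] -/
theorem k2r_ref_J_facts {R : ℝ} (hR : 1 ≤ R) :
    IntegrableOn (fun E : ℝ => E ^ 2 * (((1 + E) ^ 3)⁻¹ * Real.exp (-E / R))) (Ioi 0) ∧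
    IntegrableOn (fun E : ℝ => E ^ 3 * ((1 + E) ^ 4)⁻¹ * Real.exp (-E / R)) (Ioi 0) ∧
    Real.log R / 25 ≤ (∫ E in Ioi (0 : ℝ), E ^ 2 * (((1 + E) ^ 3)⁻¹ * Real.exp (-E / R))) ∧
    |(∫ E in Ioi (0 : ℝ), E ^ 2 * (((1 + E) ^ 3)⁻¹ * Real.exp (-E / R))) -
        ∫ E in Ioi (0 : ℝ), E ^ 3 * ((1 + E) ^ 4)⁻¹ * Real.exp (-E / R)| ≤ 4 ∧
    0 ≤ ∫ E in Ioi (0 : ℝ), E ^ 3 * ((1 + E) ^ 4)⁻¹ * Real.exp (-E / R) := by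
  have hR0 : 0 < R := by linarith
  have hI1 : IntegrableOn (fun E : ℝ => E ^ 2 * (((1 + E) ^ 3)⁻¹ * Real.exp (-E / R))) (Ioi 0) :=
    (k2r_ref_integrableOn_moment hR0 (by norm_num : 2 ≤ 3)).congr_fun (fun E _ => by ring)
      measurableSet_Ioi
  have hI2 := k2r_ref_integrableOn_moment hR0 (by norm_num : 3 ≤ 4)
  refine ⟨hI1, hI2, ?_, ?_, setIntegral_nonneg measurableSet_Ioi fun E hE => by
    have := mem_Ioi.1 hE; positivity⟩
  · -- the logarithmic lower bound
    have hsub : Ioc 1 R ⊆ Ioi 0 := fun E hE => mem_Ioi.2 (by linarith [hE.1])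
    have h1 : ∫ E in Ioc 1 R, E ^ 2 * (((1 + E) ^ 3)⁻¹ * Real.exp (-E / R)) ≤
        ∫ E in Ioi (0 : ℝ), E ^ 2 * (((1 + E) ^ 3)⁻¹ * Real.exp (-E / R)) :=
      setIntegral_mono_set hI1 (ae_restrict_of_forall_mem measurableSet_Ioi fun E hE => by
        have := mem_Ioi.1 hE; positivity) hsub.eventuallyLE
    have hcI : IntegrableOn (fun E : ℝ => (8 * Real.exp 1)⁻¹ * E⁻¹) (Ioc 1 R) := by
      refine (ContinuousOn.integrableOn_Icc (continuousOn_const.mul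
        (continuousOn_inv₀.mono fun E hE => ?_))).mono_set Ioc_subset_Icc_self
      exact mem_compl_singleton_iff.2 (by linarith [hE.1] : (0 : ℝ) < E).ne'
    have h2 : ∫ E in Ioc 1 R, (8 * Real.exp 1)⁻¹ * E⁻¹ ≤
        ∫ E in Ioc 1 R, E ^ 2 * (((1 + E) ^ 3)⁻¹ * Real.exp (-E / R)) := by
      refine setIntegral_mono_on hcI (hI1.mono_set hsub) measurableSet_Ioc fun E hE => ?_
      have hE0 : 0 < E := by linarith [hE.1]
      have h3 : (8 * E)⁻¹ ≤ E ^ 2 * ((1 + E) ^ 3)⁻¹ := by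
        rw [← div_eq_mul_inv, ← one_div, div_le_div_iff₀ (by positivity) (by positivity)]
        have h4 : (1 + E) ^ 3 ≤ (2 * E) ^ 3 := pow_le_pow_left₀ (by linarith) (by linarith [hE.1]) 3
        nlinarith
      have h5 : (Real.exp 1)⁻¹ ≤ Real.exp (-E / R) := by
        rw [← Real.exp_neg, Real.exp_le_exp, neg_div, neg_le_neg_iff, div_le_one hR0]
        exact hE.2
      calc (8 * Real.exp 1)⁻¹ * E⁻¹ = (8 * E)⁻¹ * (Real.exp 1)⁻¹ := by
            rw [mul_inv, mul_inv]; ring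
        _ ≤ E ^ 2 * ((1 + E) ^ 3)⁻¹ * Real.exp (-E / R) :=
            mul_le_mul h3 h5 (by positivity) (by positivity)
        _ = _ := mul_assoc _ _ _
    have h6 : ∫ E in Ioc 1 R, (8 * Real.exp 1)⁻¹ * E⁻¹ = (8 * Real.exp 1)⁻¹ * Real.log R := by
      rw [integral_const_mul, ← intervalIntegral.integral_of_le hR, integral_inv_of_pos one_pos hR0,
        div_one]
    have he : (1 : ℝ) / 25 ≤ (8 * Real.exp 1)⁻¹ := by
      rw [one_div, inv_le_inv₀ (by norm_num) (by positivity)]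
      have := Real.exp_one_lt_d9
      norm_num at this ⊢
      linarith
    calc Real.log R / 25 = 1 / 25 * Real.log R := by ring
      _ ≤ (8 * Real.exp 1)⁻¹ * Real.log R := mul_le_mul_of_nonneg_right he (Real.log_nonneg hR)
      _ ≤ _ := by rw [← h6]; exact h2.trans h1
  · -- `0 ≤ J - J' ≤ π/2`
    have hdiff : (∫ E in Ioi (0 : ℝ), E ^ 2 * (((1 + E) ^ 3)⁻¹ * Real.exp (-E / R))) -
        (∫ E in Ioi (0 : ℝ), E ^ 3 * ((1 + E) ^ 4)⁻¹ * Real.exp (-E / R)) =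
        ∫ E in Ioi (0 : ℝ), E ^ 2 * ((1 + E) ^ 4)⁻¹ * Real.exp (-E / R) := by
      rw [← integral_sub hI1 hI2]
      refine setIntegral_congr_fun measurableSet_Ioi fun E hE => ?_
      have hne : (1 + E) ≠ 0 := (by linarith [mem_Ioi.1 hE] : (0 : ℝ) < 1 + E).ne'
      field_simp
      ring
    have hD0 : 0 ≤ ∫ E in Ioi (0 : ℝ), E ^ 2 * ((1 + E) ^ 4)⁻¹ * Real.exp (-E / R) :=
      setIntegral_nonneg measurableSet_Ioi fun E hE => by have := mem_Ioi.1 hE; positivity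
    have hD1 : ∫ E in Ioi (0 : ℝ), E ^ 2 * ((1 + E) ^ 4)⁻¹ * Real.exp (-E / R) ≤
        ∫ E in Ioi (0 : ℝ), (1 + E ^ 2)⁻¹ := by
      refine integral_mono_of_nonneg
        (ae_restrict_of_forall_mem measurableSet_Ioi fun E hE => by
          have := mem_Ioi.1 hE; positivity)
        integrable_inv_one_add_sq.integrableOn
        (ae_restrict_of_forall_mem measurableSet_Ioi fun E hE => ?_)
      have hE0 : 0 < E := hE
      have h1 : Real.exp (-E / R) ≤ 1 :=
        Real.exp_le_one_iff.2 (by rw [neg_div]; exact neg_nonpos.2 (by positivity))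
      calc E ^ 2 * ((1 + E) ^ 4)⁻¹ * Real.exp (-E / R) ≤ E ^ 2 * ((1 + E) ^ 4)⁻¹ * 1 :=
            mul_le_mul_of_nonneg_left h1 (by positivity)
        _ = E ^ 2 / (1 + E) ^ 4 := by rw [mul_one, div_eq_mul_inv]
        _ ≤ (1 + E ^ 2)⁻¹ := by
            rw [← one_div, div_le_div_iff₀ (by positivity) (by positivity)]
            have : 0 ≤ 1 + 4 * E + 5 * E ^ 2 + 4 * E ^ 3 := by positivity
            nlinarith
    rw [integral_Ioi_inv_one_add_sq, Real.arctan_zero, sub_zero] at hD1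
    rw [hdiff, abs_of_nonneg hD0]
    linarith [Real.pi_le_four]

/-! ### Registered sub-goal -/

/-- **Registered sub-goal `stub_sphereCalculus_radial`** (keyed theorem of this file): the critical
logarithm `J_R = ∫₀^∞ E²(1+E)⁻³e^{-E/R} dE ≥ log R / 25` for `R ≥ 1`. [folklore] -/
theorem stub_sphereCalculus_radial : ∀ R : ℝ, 1 ≤ R → Real.log R / 25 ≤ ∫ E in Set.Ioi (0 : ℝ), E ^ 2 * (((1 + E) ^ 3)⁻¹ * Real.exp (-E / R)) :=
  fun _ hR => (k2r_ref_J_facts hR).2.2.1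

end Summit.AtomisticToContinuum.HydrodynamicLimit.Theorems.EnskogAdjointDuality

end
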